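import Mathlib
import HarnessLib
import Summits.Ventures.LatticeQCDFlow.Scaling.LinearFamilyTilt
import Summits.Ventures.LatticeQCDFlow.Scaling.TiltedProtocolRecursion
import Summits.Ventures.LatticeQCDFlow.Scaling.GeneralLayerLagLaw

/-!
# TiltedLinearProtocol — the tilted (second-moment) recursion of the linear switching protocol
# `S_c = S₀ + c·D` with ARBITRARY relaxation layers: per-step inequalities for the tilted mass and
# the deviation from equilibrium, against the perfect-relaxation factors `Z(c_k + 2δ_k)/Z(c_k)`

HONEST FRAMING: exact (Metropolis-corrected) sampling algorithms for lattice gauge theory;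
figures of merit are autocorrelation/cost numbers at stated couplings and volumes; no
continuum-physics claim.

Venture `LatticeQCDFlow` (cell pub-lqcd), topic `Scaling`; FANOUT row 19 (`su2-snf`, GEN-6).
OUR WORK (elementary finite sums), nothing here is cited as a fact.  Vocabulary: row 8's
`linAction S₀ D c = S₀ + c•D`, `gibbsLaw`, `partitionFn`, `varD S₀ D c = Var_c(D)`
(`Exactness/…`), `Scaling/LinearFamilyTilt` (tilt identities of the family, this seat),
`Scaling/TiltedProtocolRecursion` (`tiltEvolve`, `massDev`, this seat) and
`Scaling/GeneralLayerLagLaw` (row 19 GEN-5: `√χ²(π_c ‖ π_{c'}) ≤ e^{|c'−c|ΔD/2}|c'−c|√Var_c(D)`,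
`Var_c(D) ≤ ΔD²/2`).

Along a grid `c : ℕ → ℝ` with layers `P k` targeting `π_{c_{k+1}}`, the squared Jarzynski weight
of a path is `Π_k g_k(ω_k)` with the ONE-TIME WEIGHT `g_k = e^{−2δ_k D}`, `δ_k = c_{k+1} − c_k`
(`sqWeight`), so `E_F[e^{−2W}] = |ν_n|` for the tilted marginal `ν_k = sqTiltLaw S₀ D c P k`
(`sum_pathLaw_exp_neg_work_sq_eq`).  Under PERFECT relaxation `ν_k = p_k·π_{c_k}` exactly, with
`p_k = Π_{i<k} ḡ_i`, `ḡ_i = π_{c_i}[g_i] = Z(c_i + 2δ_i)/Z(c_i)` (`perfSqMass`, `sqTiltLaw_perfect`).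
For general layers this file proves the two PER-STEP INEQUALITIES that drive
`Scaling/GeneralLayerESSFloor` (writing `M_k = |δ_k|·ΔD`, `m_k = |ν_k|`,
`E_k = massDev π_{c_k} ν_k`, `|D x − D y| ≤ ΔD`, `Var_c(D) ≤ σ̄²` for all `c`):

* `sum_tiltLaw_succ_le` — TILTED MASS: `m_{k+1} ≤ ḡ_k·(m_k + 2|δ_k|·e^{M_k}·σ̄·E_k)` (the tilted
  lag bound; `√Var_{π_{c_k}}(g_k) = ḡ_k·√χ²(π_{c_k+2δ_k} ‖ π_{c_k}) ≤ ḡ_k·2|δ_k|e^{M_k}√Var(D)`);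
* `massDev_tiltLaw_succ_le` — DEVIATION: if `P k` is positive with unit row sums and
  `χ²`-contracts towards `π_{c_{k+1}}` with `ρ ≥ 0`, then
  `E_{k+1} ≤ ρ·ḡ_k·(e^{3M_k}·E_k + |δ_k|·e^{M_k/2}·σ̄·m_k)` (tilt-and-change-of-reference with the
  certificate `g_k²·π_{c_k} ≤ (e^{3M_k/2}ḡ_k)²·π_{c_{k+1}}` of `sqWeight_sq_mul_gibbsLaw_le`, the
  tilt identity `T_{g_k}π_{c_k} = π_{c_k+2δ_k}`, and `e^{3M/2} + √Var-term ≤ e^{3M}`);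
* `prod_essFrac_mul_perfSqMass` — TELESCOPING: `[Π_{k<n} ESS(π_{c_{k+1}}, π_{c_k})]·p_n =
  (Z(c_n)/Z(c_0))²` along any grid, i.e. the perfect-relaxation product of theory-2's
  `ess_perfect_relaxation` is `(Z_n/Z_0)²/p_n`.

NOT CLAIMED: any value of `ρ`, `σ̄`, `ΔD` for a lattice kernel; non-positive layers.
-/

namespace Summit.Ventures.LatticeQCDFlow.Scaling

open Finset
open Literature.Probability.MarkovChains (IsRowStochastic IsStationary stepLaw)
open Literature.Probability.ImportanceSampling (chiSqDiv chiSqDiv_def chiSqDiv_eq_sum_sq_div)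
open Summit.Ventures.LatticeQCDFlow.Exactness
open Summit.Ventures.LatticeQCDFlow.Theory2

variable {X : Type*} [Fintype X]

/-! ## The tilted recursion of the linear protocol -/

section Protocol

variable [Nonempty X]

/-- The ONE-TIME SQUARED WEIGHT of step `k` along the grid `c`: `g_k = e^{−2δ_k D}`,
`δ_k = c_{k+1} − c_k` (so that `(e^{−W})² = Π_k g_k(ω_k)`). -/
noncomputable def sqWeight (D : X → ℝ) (c : ℕ → ℝ) (k : ℕ) (x : X) : ℝ :=
  Real.exp (-(2 * (c (k + 1) - c k) * D x))

/-- The TILTED MARGINAL `ν_k` of the linear protocol started in equilibrium at `c 0` with layers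
`P k`: `ν_0 = π_{c_0}`, `ν_{k+1} = (g_k ν_k) P_k`; `|ν_n| = E_F[e^{−2W}]`. -/
noncomputable def sqTiltLaw (S₀ D : X → ℝ) (c : ℕ → ℝ) (P : ℕ → X → X → ℝ) : ℕ → X → ℝ :=
  tiltEvolve (sqWeight D c) P (gibbsLaw (linAction S₀ D (c 0)))

/-- The PERFECT-RELAXATION SECOND MOMENT up to step `k`: `p_k = Π_{i<k} π_{c_i}[g_i]
= Π_{i<k} Z(c_i + 2δ_i)/Z(c_i)`. -/
noncomputable def perfSqMass (S₀ D : X → ℝ) (c : ℕ → ℝ) (k : ℕ) : ℝ :=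
  ∏ i ∈ Finset.range k, ∑ x, gibbsLaw (linAction S₀ D (c i)) x * sqWeight D c i x

omit [Fintype X] [Nonempty X] in
/-- The one-time squared weight is positive. -/
theorem sqWeight_pos (D : X → ℝ) (c : ℕ → ℝ) (k : ℕ) (x : X) : 0 < sqWeight D c k x :=
  Real.exp_pos _

/-- The equilibrium factor `ḡ_k = π_{c_k}[g_k] = Z(c_k + 2δ_k)/Z(c_k)`. -/
theorem eqFactor_eq (S₀ D : X → ℝ) (c : ℕ → ℝ) (k : ℕ) :
    ∑ x, gibbsLaw (linAction S₀ D (c k)) x * sqWeight D c k x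
      = partitionFn (linAction S₀ D (c k + 2 * (c (k + 1) - c k)))
          / partitionFn (linAction S₀ D (c k)) :=
  sum_gibbsLaw_linAction_mul_exp S₀ D (c k) (2 * (c (k + 1) - c k))

/-- The equilibrium factor `ḡ_k` is positive. -/
theorem eqFactor_pos (S₀ D : X → ℝ) (c : ℕ → ℝ) (k : ℕ) :
    0 < ∑ x, gibbsLaw (linAction S₀ D (c k)) x * sqWeight D c k x :=
  sum_gibbsLaw_linAction_mul_exp_pos S₀ D (c k) _

omit [Nonempty X] in
/-- `p_{k+1} = p_k · ḡ_k`. -/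
theorem perfSqMass_succ (S₀ D : X → ℝ) (c : ℕ → ℝ) (k : ℕ) :
    perfSqMass S₀ D c (k + 1)
      = perfSqMass S₀ D c k * ∑ x, gibbsLaw (linAction S₀ D (c k)) x * sqWeight D c k x :=
  Finset.prod_range_succ _ _

/-- `p_k > 0`. -/
theorem perfSqMass_pos (S₀ D : X → ℝ) (c : ℕ → ℝ) (k : ℕ) : 0 < perfSqMass S₀ D c k :=
  prod_pos fun i _ => eqFactor_pos S₀ D c i

/-- The tilted law of the tilted target: `T_{g_k} π_{c_k} = π_{c_k + 2δ_k}`. -/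
theorem tilt_gibbsLaw_eq (S₀ D : X → ℝ) (c : ℕ → ℝ) (k : ℕ) :
    (fun x => gibbsLaw (linAction S₀ D (c k)) x * sqWeight D c k x
        / ∑ y, gibbsLaw (linAction S₀ D (c k)) y * sqWeight D c k y)
      = gibbsLaw (linAction S₀ D (c k + 2 * (c (k + 1) - c k))) := by
  funext x
  exact (gibbsLaw_linAction_add S₀ D (c k) (2 * (c (k + 1) - c k)) x).symm

omit [Nonempty X] in
/-- `ν_0 = π_{c_0}`. -/
theorem sqTiltLaw_zero (S₀ D : X → ℝ) (c : ℕ → ℝ) (P : ℕ → X → X → ℝ) :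
    sqTiltLaw S₀ D c P 0 = gibbsLaw (linAction S₀ D (c 0)) := rfl

omit [Nonempty X] in
/-- `ν_{k+1} = (g_k ν_k) P_k`. -/
theorem sqTiltLaw_succ (S₀ D : X → ℝ) (c : ℕ → ℝ) (P : ℕ → X → X → ℝ) (k : ℕ) :
    sqTiltLaw S₀ D c P (k + 1)
      = stepLaw (P k) (fun x => sqWeight D c k x * sqTiltLaw S₀ D c P k x) := rfl

/-- Positive layers keep the tilted marginal positive. -/
theorem sqTiltLaw_pos {S₀ D : X → ℝ} {c : ℕ → ℝ} {P : ℕ → X → X → ℝ} (hP : ∀ k x y, 0 < P k x y)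
    (k : ℕ) (x : X) : 0 < sqTiltLaw S₀ D c P k x :=
  tiltEvolve_pos (gibbsLaw_pos _) (fun k x => sqWeight_pos D c k x) hP k x

omit [Nonempty X] in
/-- **`E_F[(e^{−W})²]` is the tilted mass** of the linear protocol along any grid. -/
theorem sum_pathLaw_exp_neg_work_sq_eq (S₀ D : X → ℝ) (c : ℕ → ℝ) (P : ℕ → X → X → ℝ) (n : ℕ) :
    ∑ ω : Fin (n + 1) → X, pathLaw (gibbsLaw (linAction S₀ D (c 0))) (fun k : Fin n => P k) ω
        * Real.exp (-(work (fun k : Fin (n + 1) => linAction S₀ D (c k)) ω)) ^ 2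
      = ∑ x, sqTiltLaw S₀ D c P n x := by
  have h := sum_pathLaw_prod_mul_apply n (gibbsLaw (linAction S₀ D (c 0))) (sqWeight D c) P
    (fun _ => 1)
  simp only [mul_one] at h
  rw [sqTiltLaw, ← h]
  refine sum_congr rfl fun ω _ => ?_
  rw [exp_neg_work_sq_eq_prod]
  congr 1
  refine prod_congr rfl fun k _ => ?_
  simp only [sqWeight, Fin.val_succ, Fin.val_castSucc, linAction]
  congr 1
  ring

omit [Nonempty X] in
/-- Under PERFECT relaxation the tilted marginal is exactly `p_k · π_{c_k}`. -/
theorem sqTiltLaw_perfect (S₀ D : X → ℝ) (c : ℕ → ℝ) :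
    ∀ k, sqTiltLaw S₀ D c (fun k _ y => gibbsLaw (linAction S₀ D (c (k + 1))) y) k
      = fun x => perfSqMass S₀ D c k * gibbsLaw (linAction S₀ D (c k)) x
  | 0 => by funext x; simp [sqTiltLaw_zero, perfSqMass]
  | k + 1 => by
    rw [sqTiltLaw_succ, sqTiltLaw_perfect S₀ D c k, perfSqMass_succ]
    funext y
    simp only [stepLaw]
    rw [← sum_mul, mul_sum]
    congr 1
    exact sum_congr rfl fun x _ => by ring

/-- **Telescoping**: `[Π_{k<n} ESS(π_{c_{k+1}}, π_{c_k})] · p_n = (Z(c_n)/Z(c_0))²` along any grid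
(`ESS(π_{c'}, π_c)·Z(2c'−c)/Z(c) = (Z(c')/Z(c))²`). -/
theorem prod_essFrac_mul_perfSqMass (S₀ D : X → ℝ) (c : ℕ → ℝ) : ∀ n,
    (∏ k ∈ Finset.range n,
        essFrac (gibbsLaw (linAction S₀ D (c (k + 1)))) (gibbsLaw (linAction S₀ D (c k))))
      * perfSqMass S₀ D c n
      = (partitionFn (linAction S₀ D (c n)) / partitionFn (linAction S₀ D (c 0))) ^ 2
  | 0 => by simp [perfSqMass, div_self (partitionFn_pos (linAction S₀ D (c 0))).ne']
  | n + 1 => by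
    have ih := prod_essFrac_mul_perfSqMass S₀ D c n
    have hZ0 := (partitionFn_pos (linAction S₀ D (c 0))).ne'
    have hZn := (partitionFn_pos (linAction S₀ D (c n))).ne'
    have hZ2 := (partitionFn_pos (linAction S₀ D (2 * c (n + 1) - c n))).ne'
    rw [Finset.prod_range_succ, perfSqMass_succ, essFrac_gibbsLaw_linAction, eqFactor_eq,
      show c n + 2 * (c (n + 1) - c n) = 2 * c (n + 1) - c n by ring]
    calc (∏ k ∈ Finset.range n,
            essFrac (gibbsLaw (linAction S₀ D (c (k + 1)))) (gibbsLaw (linAction S₀ D (c k))))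
          * (partitionFn (linAction S₀ D (c (n + 1))) ^ 2
              / (partitionFn (linAction S₀ D (2 * c (n + 1) - c n))
                  * partitionFn (linAction S₀ D (c n))))
          * (perfSqMass S₀ D c n
              * (partitionFn (linAction S₀ D (2 * c (n + 1) - c n))
                  / partitionFn (linAction S₀ D (c n))))
        = ((∏ k ∈ Finset.range n,
            essFrac (gibbsLaw (linAction S₀ D (c (k + 1)))) (gibbsLaw (linAction S₀ D (c k))))
            * perfSqMass S₀ D c n)
          * (partitionFn (linAction S₀ D (c (n + 1))) ^ 2
              / partitionFn (linAction S₀ D (c n)) ^ 2) := by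
          field_simp
      _ = _ := by rw [ih]; field_simp

/-! ## The two per-step inequalities -/

/-- The relative standard deviation of the one-time weight under its target:
`√Var_{π_{c_k}}(g_k) ≤ ḡ_k · 2|δ_k| e^{|δ_k|ΔD} √Var_{c_k+2δ_k}(D)`. -/
theorem sqrt_varLaw_sqWeight_le (S₀ D : X → ℝ) (c : ℕ → ℝ) {ΔD : ℝ}
    (hD : ∀ x y, |D x - D y| ≤ ΔD) (k : ℕ) :
    Real.sqrt (varLaw (gibbsLaw (linAction S₀ D (c k))) (sqWeight D c k))
      ≤ (∑ x, gibbsLaw (linAction S₀ D (c k)) x * sqWeight D c k x)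
          * (2 * |c (k + 1) - c k| * Real.exp (|c (k + 1) - c k| * ΔD)
              * Real.sqrt (varD S₀ D (c k + 2 * (c (k + 1) - c k)))) := by
  rw [sqrt_varLaw_eq_mul_sqrt_chiSqDiv (gibbsLaw_pos _) (sum_gibbsLaw _) (eqFactor_pos S₀ D c k),
    tilt_gibbsLaw_eq]
  refine mul_le_mul_of_nonneg_left ?_ (eqFactor_pos S₀ D c k).le
  have h := sqrt_chiSqDiv_gibbsLaw_linAction_le S₀ D hD (c k + 2 * (c (k + 1) - c k)) (c k)
  have habs : |c k - (c k + 2 * (c (k + 1) - c k))| = 2 * |c (k + 1) - c k| := by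
    rw [show c k - (c k + 2 * (c (k + 1) - c k)) = -(2 * (c (k + 1) - c k)) by ring, abs_neg,
      abs_mul, abs_two]
  rw [habs] at h
  refine h.trans (le_of_eq ?_)
  rw [show 2 * |c (k + 1) - c k| * ΔD / 2 = |c (k + 1) - c k| * ΔD by ring]
  ring

/-- **TILTED MASS STEP.**  `m_{k+1} ≤ ḡ_k·(m_k + 2|δ_k|·e^{|δ_k|ΔD}·σ̄·E_k)`. -/
theorem sum_tiltLaw_succ_le (S₀ D : X → ℝ) (c : ℕ → ℝ) (P : ℕ → X → X → ℝ) {ΔD σbar : ℝ}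
    (hD : ∀ x y, |D x - D y| ≤ ΔD) (hProw : ∀ k x, ∑ y, P k x y = 1)
    (hσ0 : 0 ≤ σbar) (hσ : ∀ c, varD S₀ D c ≤ σbar ^ 2) (k : ℕ) :
    ∑ x, sqTiltLaw S₀ D c P (k + 1) x
      ≤ (∑ x, gibbsLaw (linAction S₀ D (c k)) x * sqWeight D c k x)
          * (∑ x, sqTiltLaw S₀ D c P k x
              + 2 * |c (k + 1) - c k| * Real.exp (|c (k + 1) - c k| * ΔD) * σbar
                  * massDev (gibbsLaw (linAction S₀ D (c k))) (sqTiltLaw S₀ D c P k)) := by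
  rw [sqTiltLaw_succ, sum_stepLaw_of_rowsum (hProw k)]
  have hlag := abs_sum_mul_sub_mass_mul_le (gibbsLaw_pos (linAction S₀ D (c k))) (sum_gibbsLaw _)
    (sqTiltLaw S₀ D c P k) (sqWeight D c k)
  have hsd := sqrt_varLaw_sqWeight_le S₀ D c hD k
  have hvD : Real.sqrt (varD S₀ D (c k + 2 * (c (k + 1) - c k))) ≤ σbar := by
    rw [← Real.sqrt_sq hσ0]; exact Real.sqrt_le_sqrt (hσ _)
  have hE := massDev_nonneg (gibbsLaw (linAction S₀ D (c k))) (sqTiltLaw S₀ D c P k)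
  have hg := (eqFactor_pos S₀ D c k).le
  have h2 : 0 ≤ 2 * |c (k + 1) - c k| * Real.exp (|c (k + 1) - c k| * ΔD) := by positivity
  have hsd' : Real.sqrt (varLaw (gibbsLaw (linAction S₀ D (c k))) (sqWeight D c k))
      ≤ (∑ x, gibbsLaw (linAction S₀ D (c k)) x * sqWeight D c k x)
          * (2 * |c (k + 1) - c k| * Real.exp (|c (k + 1) - c k| * ΔD) * σbar) :=
    hsd.trans (mul_le_mul_of_nonneg_left (mul_le_mul_of_nonneg_left hvD h2) hg)
  have := (le_abs_self _).trans hlag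
  nlinarith [mul_le_mul_of_nonneg_right hsd' hE]

/-- **The change-of-reference certificate**: `g_k(x)²·π_{c_k}(x) ≤ (e^{3|δ_k|ΔD/2}·ḡ_k)²·π_{c_{k+1}}(x)`
(termwise domination of `e^{−4δD(x)}·π[e^{−δD}]` by `e^{3|δ|ΔD}·e^{−δD(x)}·π[e^{−2δD}]²`). -/
theorem sqWeight_sq_mul_gibbsLaw_le (S₀ D : X → ℝ) (c : ℕ → ℝ) {ΔD : ℝ}
    (hD : ∀ x y, |D x - D y| ≤ ΔD) (k : ℕ) (x : X) :
    sqWeight D c k x ^ 2 * gibbsLaw (linAction S₀ D (c k)) x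
      ≤ (Real.exp (3 * (|c (k + 1) - c k| * ΔD) / 2)
            * ∑ y, gibbsLaw (linAction S₀ D (c k)) y * sqWeight D c k y) ^ 2
          * gibbsLaw (linAction S₀ D (c (k + 1))) x := by
  set δ := c (k + 1) - c k with hδ
  set π := gibbsLaw (linAction S₀ D (c k)) with hπ
  have hπpos : ∀ y, 0 < π y := fun y => gibbsLaw_pos _ y
  have hπ1 : ∑ y, π y = 1 := sum_gibbsLaw _
  -- the next law is the `e^{−δD}`-tilt of the current one
  have hπ' : gibbsLaw (linAction S₀ D (c (k + 1))) x
      = π x * Real.exp (-(δ * D x)) / ∑ y, π y * Real.exp (-(δ * D y)) := by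
    have h := gibbsLaw_linAction_add S₀ D (c k) δ x
    rwa [show c k + δ = c (k + 1) by rw [hδ]; ring] at h
  set hbar := ∑ y, π y * Real.exp (-(δ * D y)) with hhbar
  have hhpos : 0 < hbar := sum_pos (fun y _ => mul_pos (hπpos y) (Real.exp_pos _)) univ_nonempty
  set gbar := ∑ y, π y * sqWeight D c k y with hgbar
  have hA2 : Real.exp (3 * (|δ| * ΔD) / 2) ^ 2 = Real.exp (3 * (|δ| * ΔD)) := by
    rw [← Real.exp_nat_mul]; congr 1; push_cast; ring
  -- the key termwise domination
  have key : sqWeight D c k x ^ 2 * hbar ≤ Real.exp (3 * (|δ| * ΔD)) * gbar ^ 2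
      * Real.exp (-(δ * D x)) := by
    have lhs : sqWeight D c k x ^ 2 * hbar
        = ∑ y, ∑ y', π y * π y' * Real.exp (-(4 * δ * D x) - δ * D y) := by
      rw [hhbar, mul_sum]
      refine sum_congr rfl fun y _ => ?_
      rw [show sqWeight D c k x ^ 2 * (π y * Real.exp (-(δ * D y)))
          = (π y * (sqWeight D c k x ^ 2 * Real.exp (-(δ * D y)))) * ∑ y', π y' by
            rw [hπ1]; ring, mul_sum]
      refine sum_congr rfl fun y' _ => ?_
      simp only [sqWeight, ← hδ]
      rw [sq, ← Real.exp_add, ← Real.exp_add]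
      ring_nf
    have rhs : Real.exp (3 * (|δ| * ΔD)) * gbar ^ 2 * Real.exp (-(δ * D x))
        = ∑ y, ∑ y', π y * π y'
            * Real.exp (3 * (|δ| * ΔD) - 2 * δ * D y - 2 * δ * D y' - δ * D x) := by
      rw [hgbar, sq, sum_mul_sum, mul_sum, sum_mul]
      refine sum_congr rfl fun y _ => ?_
      rw [mul_sum, sum_mul]
      refine sum_congr rfl fun y' _ => ?_
      simp only [sqWeight, ← hδ]
      rw [show 3 * (|δ| * ΔD) - 2 * δ * D y - 2 * δ * D y' - δ * D x
          = 3 * (|δ| * ΔD) + -(2 * δ * D y) + -(2 * δ * D y') + -(δ * D x) by ring,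
        Real.exp_add, Real.exp_add, Real.exp_add]
      ring
    rw [lhs, rhs]
    refine sum_le_sum fun y _ => sum_le_sum fun y' _ => ?_
    refine mul_le_mul_of_nonneg_left (Real.exp_le_exp.mpr ?_)
      (mul_nonneg (hπpos y).le (hπpos y').le)
    have h1 : |δ * (D x - D y)| ≤ |δ| * ΔD := by
      rw [abs_mul]; exact mul_le_mul_of_nonneg_left (hD x y) (abs_nonneg _)
    have h2 : |δ * (D x - D y')| ≤ |δ| * ΔD := by
      rw [abs_mul]; exact mul_le_mul_of_nonneg_left (hD x y') (abs_nonneg _)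
    have h1' := (abs_le.mp h1).1
    have h2' := (abs_le.mp h2).1
    nlinarith [h1', h2']
  rw [hπ',
    show (Real.exp (3 * (|δ| * ΔD) / 2) * gbar) ^ 2 * (π x * Real.exp (-(δ * D x)) / hbar)
      = (Real.exp (3 * (|δ| * ΔD) / 2) ^ 2 * gbar ^ 2 * Real.exp (-(δ * D x)) * π x) / hbar by
        ring,
    le_div_iff₀ hhpos, hA2]
  linarith [mul_le_mul_of_nonneg_right key (hπpos x).le]

/-- **DEVIATION STEP.**  If `P k` is positive with unit row sums and `χ²`-contracts towards
`π_{c_{k+1}}` with `ρ ≥ 0`, then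
`E_{k+1} ≤ ρ·ḡ_k·(e^{3|δ_k|ΔD}·E_k + |δ_k|·e^{|δ_k|ΔD/2}·σ̄·m_k)`. -/
theorem massDev_tiltLaw_succ_le (S₀ D : X → ℝ) (c : ℕ → ℝ) (P : ℕ → X → X → ℝ) {ΔD ρ σbar : ℝ}
    (hD : ∀ x y, |D x - D y| ≤ ΔD) (hPpos : ∀ k x y, 0 < P k x y)
    (hProw : ∀ k x, ∑ y, P k x y = 1)
    (hK : ∀ k, ChiSqContracts (P k) (gibbsLaw (linAction S₀ D (c (k + 1)))) ρ) (hρ : 0 ≤ ρ)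
    (hσ0 : 0 ≤ σbar) (hσ : ∀ c, varD S₀ D c ≤ σbar ^ 2) (k : ℕ) :
    massDev (gibbsLaw (linAction S₀ D (c (k + 1)))) (sqTiltLaw S₀ D c P (k + 1))
      ≤ ρ * (∑ x, gibbsLaw (linAction S₀ D (c k)) x * sqWeight D c k x)
          * (Real.exp (3 * (|c (k + 1) - c k| * ΔD))
                * massDev (gibbsLaw (linAction S₀ D (c k))) (sqTiltLaw S₀ D c P k)
            + |c (k + 1) - c k| * Real.exp (|c (k + 1) - c k| * ΔD / 2) * σbar
                * ∑ x, sqTiltLaw S₀ D c P k x) := by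
  set δ := c (k + 1) - c k with hδ
  set π := gibbsLaw (linAction S₀ D (c k)) with hπ
  set π' := gibbsLaw (linAction S₀ D (c (k + 1))) with hπ'
  set ν := sqTiltLaw S₀ D c P k with hν
  set g := sqWeight D c k with hg
  set gbar := ∑ x, π x * g x with hgbar
  have hπpos : ∀ y, 0 < π y := fun y => gibbsLaw_pos _ y
  have hπ1 : ∑ y, π y = 1 := sum_gibbsLaw _
  have hπ'pos : ∀ y, 0 < π' y := fun y => gibbsLaw_pos _ y
  have hπ'1 : ∑ y, π' y = 1 := sum_gibbsLaw _
  have hgbar0 : 0 < gbar := eqFactor_pos S₀ D c k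
  have hνpos : ∀ x, 0 < ν x := fun x => sqTiltLaw_pos hPpos k x
  have hm0 : 0 < ∑ x, ν x := sum_pos (fun x _ => hνpos x) univ_nonempty
  have hgν0 : ∑ x, g x * ν x ≠ 0 :=
    (sum_pos (fun x _ => mul_pos (sqWeight_pos D c k x) (hνpos x)) univ_nonempty).ne'
  have hE := massDev_nonneg π ν
  have hM0 : 0 ≤ |δ| * ΔD := mul_nonneg (abs_nonneg _) ((abs_nonneg _).trans (hD (Classical.arbitrary X) (Classical.arbitrary X)))
  -- (1) contraction by the layer
  have h1 : massDev π' (sqTiltLaw S₀ D c P (k + 1)) ≤ ρ * massDev π' (fun x => g x * ν x) := by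
    rw [sqTiltLaw_succ]
    exact massDev_stepLaw_le (hK k) (hProw k) hρ hgν0
  -- (2) tilt and change of reference
  have hC0 : 0 ≤ Real.exp (3 * (|δ| * ΔD) / 2) * gbar := by positivity
  have h2 := massDev_tilt_le (ν := ν) hπpos hπ1 hπ'pos hπ'1 hgbar0 hC0
    (fun x => sqWeight_sq_mul_gibbsLaw_le S₀ D c hD k x)
  rw [abs_of_pos hm0] at h2
  -- (3) the Gibbs-family bounds
  have htilt : (fun x => π x * g x / ∑ y, π y * g y)
      = gibbsLaw (linAction S₀ D (c k + 2 * δ)) := tilt_gibbsLaw_eq S₀ D c k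
  have hd' : Real.sqrt (chiSqDiv (fun x => π x * g x / ∑ y, π y * g y) π')
      ≤ Real.exp (|δ| * ΔD / 2) * (|δ| * σbar) := by
    rw [htilt]
    have h := sqrt_chiSqDiv_gibbsLaw_linAction_le S₀ D hD (c k + 2 * δ) (c (k + 1))
    have habs : |c (k + 1) - (c k + 2 * δ)| = |δ| := by
      rw [show c (k + 1) - (c k + 2 * δ) = -δ by rw [hδ]; ring, abs_neg]
    rw [habs] at h
    refine h.trans (mul_le_mul_of_nonneg_left (mul_le_mul_of_nonneg_left ?_ (abs_nonneg _))
      (Real.exp_pos _).le)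
    rw [← Real.sqrt_sq hσ0]; exact Real.sqrt_le_sqrt (hσ _)
  have hsd := sqrt_varLaw_sqWeight_le S₀ D c hD k
  -- relative standard deviation folded into the contraction factor
  have hy2 : (2 * |δ| * Real.sqrt (varD S₀ D (c k + 2 * δ))) ^ 2 ≤ 2 * (|δ| * ΔD) ^ 2 := by
    have hv := varD_le_sq_of_osc S₀ D hD (c k + 2 * δ)
    have hv0 := varD_nonneg S₀ D (c k + 2 * δ)
    rw [mul_pow, mul_pow, Real.sq_sqrt hv0]
    nlinarith [sq_nonneg δ, sq_abs δ]
  have hfold := exp_three_halves_add_le hM0 (by positivity) hy2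
  have hsd' : Real.sqrt (varLaw π g)
      ≤ gbar * (Real.exp (|δ| * ΔD) * (2 * |δ| * Real.sqrt (varD S₀ D (c k + 2 * δ)))) :=
    hsd.trans (le_of_eq (by ring))
  -- assemble
  have hsum : Real.exp (3 * (|δ| * ΔD) / 2) * gbar * massDev π ν
        + (∑ x, ν x) * gbar * Real.sqrt (chiSqDiv (fun x => π x * g x / ∑ y, π y * g y) π')
        + Real.sqrt (varLaw π g) * massDev π ν
      ≤ gbar * (Real.exp (3 * (|δ| * ΔD)) * massDev π ν
          + |δ| * Real.exp (|δ| * ΔD / 2) * σbar * ∑ x, ν x) := by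
    have t2 := mul_le_mul_of_nonneg_left hd' (mul_nonneg hm0.le hgbar0.le)
    have t3 := mul_le_mul_of_nonneg_right hsd' hE
    have t13 : Real.exp (3 * (|δ| * ΔD) / 2) * gbar * massDev π ν
          + gbar * (Real.exp (|δ| * ΔD) * (2 * |δ| * Real.sqrt (varD S₀ D (c k + 2 * δ))))
              * massDev π ν
        ≤ gbar * (Real.exp (3 * (|δ| * ΔD)) * massDev π ν) := by
      have := mul_le_mul_of_nonneg_right hfold (mul_nonneg hgbar0.le hE)
      nlinarith [this]
    nlinarith [t2, t3, t13]
  calc massDev π' (sqTiltLaw S₀ D c P (k + 1))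
      ≤ ρ * massDev π' (fun x => g x * ν x) := h1
    _ ≤ ρ * (gbar * (Real.exp (3 * (|δ| * ΔD)) * massDev π ν
          + |δ| * Real.exp (|δ| * ΔD / 2) * σbar * ∑ x, ν x)) :=
        mul_le_mul_of_nonneg_left (h2.trans hsum) hρ
    _ = _ := by ring

end Protocol

end Summit.Ventures.LatticeQCDFlow.Scaling
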